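import Literature.NumberTheory.EllipticCurves.CuspFormTwist
import Literature.NumberTheory.EllipticCurves.Gamma1NewformLSeriesProofs
import Literature.NumberTheory.EllipticCurves.Gamma1NewformLSeriesFrickeProofs
import Literature.NumberTheory.EllipticCurves.NewformsSpanGamma1Proofs
import Literature.NumberTheory.EllipticCurves.DeligneSerreProp27Proofs
import Literature.NumberTheory.EllipticCurves.NewformsEigenpacketProofs
import Literature.NumberTheory.EllipticCurves.NewformEigencharacter
import HarnessLib

/-!
# Twists of cusp forms on `Γ₁(N)` with nebentypus by Dirichlet characters (Shimura 1971, Prop. 3.64)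

Topic `NumberTheory/EllipticCurves` (classical modular forms); definitions and theorems, everything
proved, no named fact. The sibling `CuspFormTwist` treats `f ∈ S_k(Γ₀(N))` (trivial nebentypus, the
quadratic twists of elliptic curves). This file treats **`f ∈ S_k(N, ψ) ⊆ S_k(Γ₁(N))`** with
nebentypus `ψ` (Shimura 1971, Prop. 3.64 in full: "`f_χ ∈ S_k(Γ₀(M), ψχ²)`, `M = lcm(N, r², r𝔣_ψ)`"),
as needed to twist weight-one newforms back in the weight-one dictionary
(`StrongArtinGL2WeightOneDescent`):

* `exists_twistT_mul_mapGL_eq'` — the commutation relation `[1,u/m;0,1] γ = γ' [1,d²u/m;0,1]` of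
  `CuspFormTwist`, with the extra information `c ∣ m (d' - d)` on the lower-right entries
  (so `d' ≡ d (mod N)` when `N m ∣ c`);
* `twistTranslate1`, `twistRaw1 L … hf χ = ∑_u χ⁻¹(u) f(τ + u/m) ∈ S_k(Γ₁(L))` for `N ∣ L`, `m² ∣ L`,
  `N m ∣ L`, and its transformation law `twistRaw1 ∣ γ = ψ(d) χ(d)² • twistRaw1` under `Γ₀(L)`
  (`coe_twistRaw1_slash`), i.e. `twistRaw1 ∈ S_k(L, ψχ²)` (`twistRaw1_mem_nebentypusSubspace`);
* the `q`-expansion `aₙ = χ(n) g(χ⁻¹) aₙ(f)` for primitive `χ` (`cuspCoeff_twistRaw1`), non-vanishing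
  (`twistRaw1_ne_zero`), and **`T_p (f ⊗ χ) = χ(p) a_p • (f ⊗ χ)` for `T_p f = a_p f`, `p ∤ L`**
  (`heckeT_twistRaw1`, by comparing `q`-expansions, Diamond–Shurman (5.3) on both levels);
* `exists_isNewform1_twist` — **for a newform `g ∈ S_k(Γ₁(N))` and a primitive `χ` mod `m` there is a
  newform `g₀` of level dividing `N m²` with `a_p(g₀) = χ(p) a_p(g)` and `ε_{g₀}(p) = ε_g(p) χ(p)²`
  for all primes `p ∤ N m`** (the eigenvalue packet of `g ⊗ χ`, `exists_isNewform1_of_eigenpacket`;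
  Atkin–Li 1978, §3: the newform attached to a twist).

## References

* G. Shimura, *Introduction to the arithmetic theory of automorphic functions* (1971), Prop. 3.64,
  Thm. 3.66 [Shimura1971].
* A. O. L. Atkin, W.-C. W. Li, *Twists of newforms and pseudo-eigenvalues of `W`-operators*,
  Invent. Math. 48 (1978), §3 [AtkinLi1978].
* F. Diamond, J. Shurman, *A first course in modular forms* (2005), Prop. 5.2.2 (5.3), §5.8
  [DiamondShurman2005].
-/

noncomputable section

open scoped MatrixGroups ModularForm Real

open CongruenceSubgroup Matrix.SpecialLinearGroup Matrix.GeneralLinearGroup UpperHalfPlane Complex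

namespace Literature.NumberTheory.EllipticCurves.ModularForms

/-! ### The commutation relation, with control of the lower-right entry -/

section Matrices

variable {m : ℕ}

/-- **The commutation relation behind twisting, with the lower-right entry** (Shimura 1971, proof of
Prop. 3.64): for `γ = (a b; c d) ∈ SL(2, ℤ)` with `m² ∣ c` and `u mod m`,
`[1, u/m; 0, 1] γ = γ' [1, d²u/m; 0, 1]` with `γ' ∈ SL(2, ℤ)`, `γ'₁₀ = c` and `c ∣ m (γ'₁₁ - d)`
(explicitly `γ'₁₁ = d - (c/m) V`). [cite: Shimura1971, Prop. 3.64] -/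
theorem exists_twistT_mul_mapGL_eq' [NeZero m] (γ : SL(2, ℤ)) (hc : ((m : ℤ) ^ 2) ∣ γ 1 0)
    (u : ZMod m) :
    ∃ γ' : SL(2, ℤ), γ' 1 0 = γ 1 0 ∧ (γ 1 0 ∣ (m : ℤ) * (γ' 1 1 - γ 1 1)) ∧
      twistT u * (mapGL ℝ γ : GL (Fin 2) ℝ) =
        (mapGL ℝ γ' : GL (Fin 2) ℝ) * twistT ((((γ 1 1 : ℤ) : ZMod m)) ^ 2 * u) := by
  obtain ⟨c₂, hc₂⟩ := hc
  set a := γ 0 0 with ha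
  set b := γ 0 1 with hb
  set c := γ 1 0 with hc
  set d := γ 1 1 with hd
  set v : ZMod m := ((d : ZMod m)) ^ 2 * u with hv
  set U : ℤ := (u.val : ℤ) with hU
  set V : ℤ := (v.val : ℤ) with hV
  have hm0 : (m : ℝ) ≠ 0 := by exact_mod_cast NeZero.ne m
  have hdet : a * d - b * (m ^ 2 * c₂) = 1 := by
    have := det_entries γ
    rw [← hc₂]
    linear_combination this
  have hmc : (m : ℤ) ∣ γ 1 0 := ⟨m * c₂, by rw [← hc, hc₂]; ring⟩
  have had : (a : ZMod m) * (d : ZMod m) = 1 := natCast_mul_natCast_eq_one_of_dvd γ hmc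
  -- `m ∣ dU - aV`
  have hdvd : (m : ℤ) ∣ d * U - a * V := by
    rw [← ZMod.intCast_zmod_eq_zero_iff_dvd]
    have hUc : ((U : ℤ) : ZMod m) = u := by simp [hU]
    have hVc : ((V : ℤ) : ZMod m) = v := by simp [hV]
    push_cast
    rw [hUc, hVc, hv]
    linear_combination (-((d : ZMod m) * u)) * had
  obtain ⟨t, ht⟩ := hdvd
  let A : Matrix (Fin 2) (Fin 2) ℤ :=
    !![a + m * c₂ * U, b + t - c₂ * U * V; m ^ 2 * c₂, d - m * c₂ * V]
  have hA : A.det = 1 := by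
    rw [Matrix.det_fin_two_of]
    linear_combination hdet + m * c₂ * ht
  refine ⟨⟨A, hA⟩, ?_, ?_, ?_⟩
  · change A 1 0 = c
    simp [A, hc₂]
  · change c ∣ (m : ℤ) * (A 1 1 - d)
    have hA11 : A 1 1 = d - m * c₂ * V := by simp [A]
    rw [hA11, hc₂]
    exact ⟨-V, by ring⟩
  · refine Units.ext ?_
    simp only [Matrix.GeneralLinearGroup.coe_mul, val_twistT, val_mapGL']
    have hUr : ((u.val : ℕ) : ℝ) = (U : ℝ) := by rw [hU]; push_cast; rfl
    have hVr : ((v.val : ℕ) : ℝ) = (V : ℝ) := by rw [hV]; push_cast; rfl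
    have hcr : ((γ 1 0 : ℤ) : ℝ) = (m : ℝ) ^ 2 * c₂ := by rw [← hc, hc₂]; push_cast; ring
    have htr : (d : ℝ) * U - a * V = m * t := by exact_mod_cast ht
    rw [hUr, hVr]
    ext i j
    fin_cases i <;> fin_cases j <;>
      simp [Matrix.mul_apply, Fin.sum_univ_two, A, hcr, ← ha, ← hb, ← hd] <;> field_simp <;>
      (first | ring1 | linear_combination htr)

end Matrices

/-! ### Translates and the raw twist of a form with nebentypus -/

section Raw

variable {N : ℕ} {k : ℤ} {m : ℕ}

/-- A matrix of `SL(2, ℤ)` with the lower-left entry of an element of `Γ₀(L)`, `N ∣ L`, as an element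
of `Γ₀(N)`. [folklore] -/
def gamma0OfEntryEq {L : ℕ} (hN : N ∣ L) {γ γ' : SL(2, ℤ)} (hγ : γ ∈ Gamma0 L) (h : γ' 1 0 = γ 1 0) :
    Gamma0 N :=
  ⟨γ', mem_Gamma0_of_entry_eq hN hγ h⟩

/-- The lower-right entries of `γ` and `γ'` agree mod `N` when `c ∣ m (d' - d)`, `γ ∈ Γ₀(L)` and
`N m ∣ L`. [folklore] -/
theorem intCast_entry_eq_of_dvd [NeZero m] {L : ℕ} (hNm : N * m ∣ L) {γ γ' : SL(2, ℤ)} (hγ : γ ∈ Gamma0 L)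
    (h : γ 1 0 ∣ (m : ℤ) * (γ' 1 1 - γ 1 1)) : ((γ' 1 1 : ℤ) : ZMod N) = ((γ 1 1 : ℤ) : ZMod N) := by
  have h1 : ((N * m : ℕ) : ℤ) ∣ (m : ℤ) * (γ' 1 1 - γ 1 1) :=
    ((Int.natCast_dvd_natCast.mpr hNm).trans (dvd_entry_of_mem_Gamma0 L hγ)).trans h
  rw [Nat.cast_mul, mul_comm] at h1
  have h2 : (N : ℤ) ∣ γ' 1 1 - γ 1 1 :=
    Int.dvd_of_mul_dvd_mul_left (by exact_mod_cast NeZero.ne m) h1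
  rw [← sub_eq_zero, ← Int.cast_sub, ZMod.intCast_zmod_eq_zero_iff_dvd]
  exact h2

/-- **Slashing a translate of a form with nebentypus** (Shimura 1971, proof of Prop. 3.64): for
`f ∈ S_k(N, ψ)` and `γ = (a b; c d) ∈ Γ₀(L)` (`N ∣ L`, `m² ∣ L`, `N m ∣ L`),
`(f ∣ [1,u/m;0,1]) ∣ γ = ψ(d) • f ∣ [1, d²u/m; 0, 1]`. [cite: Shimura1971, Prop. 3.64] -/
theorem slash_twistT_slash_mapGL_of_mem_nebentypusSubspace [NeZero N] [NeZero m] {L : ℕ} (hN : N ∣ L)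
    (hm : m ^ 2 ∣ L) (hNm : N * m ∣ L) {ψ : DirichletCharacter ℂ N} {f : CuspForm (Gamma1 N) k}
    (hf : f ∈ nebentypusSubspace N k ψ) {γ : SL(2, ℤ)} (hγ : γ ∈ Gamma0 L) (u : ZMod m) :
    ((⇑f : ℍ → ℂ) ∣[k] twistT u) ∣[k] (mapGL ℝ γ : GL (Fin 2) ℝ) =
      ψ (((γ 1 1 : ℤ) : ZMod N)) • (⇑f : ℍ → ℂ) ∣[k] twistT ((((γ 1 1 : ℤ) : ZMod m)) ^ 2 * u) := by
  obtain ⟨γ', hγ'c, hγ'd, h⟩ := exists_twistT_mul_mapGL_eq' γ (sq_dvd_entry_of_mem_Gamma0 hm hγ) u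
  have hmap : Gamma0Map N (gamma0OfEntryEq hN hγ hγ'c) = ((γ 1 1 : ℤ) : ZMod N) := by
    change ((γ' 1 1 : ℤ) : ZMod N) = _
    exact intCast_entry_eq_of_dvd hNm hγ hγ'd
  have hslash : (⇑f : ℍ → ℂ) ∣[k] (mapGL ℝ γ' : GL (Fin 2) ℝ) = ψ (((γ 1 1 : ℤ) : ZMod N)) • ⇑f := by
    have h1 := coe_slash_eq_smul_of_mem_nebentypusSubspace hf (gamma0OfEntryEq hN hγ hγ'c)
    rw [hmap] at h1
    exact h1
  rw [← SlashAction.slash_mul, h, SlashAction.slash_mul, hslash, ModularForm.smul_slash, σ_twistT]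

variable [NeZero N] [NeZero m] (L : ℕ) [NeZero L]

/-- The translate `f(τ + u/m)` of `f ∈ S_k(N, ψ)`, `u mod m`, as a **cusp form on `Γ₁(L)`** for
`N ∣ L`, `m² ∣ L`, `N m ∣ L` (for `γ ∈ Γ₁(L)`, `d ≡ 1` mod `N` and mod `m`).
[cite: Shimura1971, Prop. 3.64] -/
def twistTranslate1 (hN : N ∣ L) (hm : m ^ 2 ∣ L) (hNm : N * m ∣ L) {ψ : DirichletCharacter ℂ N}
    {f : CuspForm (Gamma1 N) k} (hf : f ∈ nebentypusSubspace N k ψ) (u : ZMod m) : CuspForm (Gamma1 L) k :=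
  cuspFormOfInvariant (translateCuspForm f (twistShift u)) fun g hg ↦ by
    obtain ⟨γ, hγ, rfl⟩ := hg
    have hγ0 : γ ∈ Gamma0 L := Gamma1_in_Gamma0 L hγ
    have h1 : (((γ 1 1 : ℤ) : ZMod L)) = 1 := ((Gamma1_mem L γ).mp hγ).2.1
    have hdm : (((γ 1 1 : ℤ) : ZMod m)) = 1 := by
      have hmL : m ∣ L := (Dvd.intro_left _ (sq m).symm).trans hm
      have h2 := congrArg (ZMod.castHom hmL (ZMod m)) h1
      rwa [map_intCast, map_one] at h2
    have hdN : (((γ 1 1 : ℤ) : ZMod N)) = 1 := by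
      have h2 := congrArg (ZMod.castHom hN (ZMod N)) h1
      rwa [map_intCast, map_one] at h2
    rw [coe_translateCuspForm, show (upperRightHom ((twistShift u : ℚ) : ℝ) : GL (Fin 2) ℝ) =
      twistT u from rfl, slash_twistT_slash_mapGL_of_mem_nebentypusSubspace hN hm hNm hf hγ0 u, hdm, hdN,
      map_one, one_smul, one_pow, one_mul]

/-- `twistTranslate1` is the function `f ∣[k] [1, u/m; 0, 1]`. [folklore] -/
@[simp] theorem coe_twistTranslate1 (hN : N ∣ L) (hm : m ^ 2 ∣ L) (hNm : N * m ∣ L) {ψ : DirichletCharacter ℂ N}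
    {f : CuspForm (Gamma1 N) k} (hf : f ∈ nebentypusSubspace N k ψ) (u : ZMod m) :
    (⇑(twistTranslate1 L hN hm hNm hf u) : ℍ → ℂ) = (⇑f : ℍ → ℂ) ∣[k] twistT u :=
  rfl

/-- The **raw twist** `∑_{u mod m} χ⁻¹(u) f(τ + u/m)` of `f ∈ S_k(N, ψ)` by a Dirichlet character
`χ mod m`, as a cusp form on `Γ₁(L)` (`N ∣ L`, `m² ∣ L`, `N m ∣ L`) (Shimura 1971, Prop. 3.64:
`f_χ ∈ S_k(Γ₀(M), ψχ²)`, `M = lcm(N, r², r 𝔣_ψ)`). [cite: Shimura1971, Prop. 3.64] -/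
def twistRaw1 (hN : N ∣ L) (hm : m ^ 2 ∣ L) (hNm : N * m ∣ L) {ψ : DirichletCharacter ℂ N}
    {f : CuspForm (Gamma1 N) k} (hf : f ∈ nebentypusSubspace N k ψ) (χ : DirichletCharacter ℂ m) :
    CuspForm (Gamma1 L) k :=
  ∑ u : ZMod m, χ⁻¹ u • twistTranslate1 L hN hm hNm hf u

/-- The underlying function of the raw twist. [folklore] -/
theorem coe_twistRaw1 (hN : N ∣ L) (hm : m ^ 2 ∣ L) (hNm : N * m ∣ L) {ψ : DirichletCharacter ℂ N}
    {f : CuspForm (Gamma1 N) k} (hf : f ∈ nebentypusSubspace N k ψ) (χ : DirichletCharacter ℂ m) :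
    (⇑(twistRaw1 L hN hm hNm hf χ) : ℍ → ℂ) = ∑ u : ZMod m, χ⁻¹ u • ((⇑f : ℍ → ℂ) ∣[k] twistT u) := by
  have h := map_sum (CuspForm.coeHom (Γ := ((Gamma1 L : Subgroup SL(2, ℤ)) : Subgroup (GL (Fin 2) ℝ)))
    (k := k)) (fun u : ZMod m ↦ χ⁻¹ u • twistTranslate1 L hN hm hNm hf u) Finset.univ
  rw [twistRaw1]
  refine h.trans (Finset.sum_congr rfl fun u _ ↦ ?_)
  rfl

/-- **Transformation law of the raw twist under `Γ₀(L)`**: `(f_χ^raw) ∣ γ = ψ(d) χ(d)² • f_χ^raw`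
(Shimura 1971, Prop. 3.64: `f_χ ∈ S_k(Γ₀(M), ψχ²)`). [cite: Shimura1971, Prop. 3.64] -/
theorem coe_twistRaw1_slash (hN : N ∣ L) (hm : m ^ 2 ∣ L) (hNm : N * m ∣ L) {ψ : DirichletCharacter ℂ N}
    {f : CuspForm (Gamma1 N) k} (hf : f ∈ nebentypusSubspace N k ψ) (χ : DirichletCharacter ℂ m)
    {γ : SL(2, ℤ)} (hγ : γ ∈ Gamma0 L) :
    (⇑(twistRaw1 L hN hm hNm hf χ) : ℍ → ℂ) ∣[k] (mapGL ℝ γ : GL (Fin 2) ℝ) =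
      (ψ (((γ 1 1 : ℤ) : ZMod N)) * (χ (((γ 1 1 : ℤ) : ZMod m))) ^ 2) • (⇑(twistRaw1 L hN hm hNm hf χ) : ℍ → ℂ) := by
  have hunit : IsUnit (((γ 1 1 : ℤ) : ZMod m)) :=
    isUnit_intCast_entry_of_dvd γ
      ((dvd_pow_self (m : ℤ) two_ne_zero).trans (sq_dvd_entry_of_mem_Gamma0 hm hγ))
  obtain ⟨dU, hdU⟩ := hunit
  rw [coe_twistRaw1, finset_sum_slash]
  have h1 : ∀ u : ZMod m, (χ⁻¹ u • ((⇑f : ℍ → ℂ) ∣[k] twistT u)) ∣[k] (mapGL ℝ γ : GL (Fin 2) ℝ) =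
      (ψ (((γ 1 1 : ℤ) : ZMod N)) * χ⁻¹ u) • ((⇑f : ℍ → ℂ) ∣[k] twistT (((dU ^ 2 : (ZMod m)ˣ) : ZMod m) * u)) := by
    intro u
    rw [ModularForm.smul_slash, σ_mapGL, slash_twistT_slash_mapGL_of_mem_nebentypusSubspace hN hm hNm hf hγ u,
      ← hdU, Units.val_pow_eq_pow_val, smul_smul, mul_comm]
  simp_rw [h1]
  rw [Fintype.sum_equiv (Units.mulLeft (dU ^ 2))
    (fun u : ZMod m ↦ (ψ (((γ 1 1 : ℤ) : ZMod N)) * χ⁻¹ u) •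
      ((⇑f : ℍ → ℂ) ∣[k] twistT (((dU ^ 2 : (ZMod m)ˣ) : ZMod m) * u)))
    (fun w : ZMod m ↦ (ψ (((γ 1 1 : ℤ) : ZMod N)) * χ⁻¹ ((((dU ^ 2)⁻¹ : (ZMod m)ˣ) : ZMod m) * w)) •
      ((⇑f : ℍ → ℂ) ∣[k] twistT w))
    (fun u ↦ by rw [Units.mulLeft_apply, Units.inv_mul_cancel_left]), Finset.smul_sum]
  refine Finset.sum_congr rfl fun w _ ↦ ?_
  rw [smul_smul, map_mul, MulChar.inv_apply, Ring.inverse_unit, inv_inv, ← hdU,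
    Units.val_pow_eq_pow_val, map_pow]
  ring_nf

/-- **The raw twist lies in `S_k(L, ψχ²)`** (both characters read mod `L`). [cite: Shimura1971, Prop. 3.64] -/
theorem twistRaw1_mem_nebentypusSubspace (hN : N ∣ L) (hm : m ^ 2 ∣ L) (hNm : N * m ∣ L) (hmL : m ∣ L)
    {ψ : DirichletCharacter ℂ N} {f : CuspForm (Gamma1 N) k} (hf : f ∈ nebentypusSubspace N k ψ)
    (χ : DirichletCharacter ℂ m) :
    twistRaw1 L hN hm hNm hf χ ∈ nebentypusSubspace L k
      (DirichletCharacter.changeLevel hN ψ * DirichletCharacter.changeLevel hmL χ ^ 2) := by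
  refine mem_nebentypusSubspace_of_forall_slash fun γ ↦ ?_
  rw [coe_twistRaw1_slash L hN hm hNm hf χ γ.2, MulChar.mul_apply, MulChar.pow_apply' _ two_ne_zero]
  congr 1
  have hcop : IsCoprime (((γ : SL(2, ℤ)) 1 1 : ℤ)) (L : ℤ) := by
    have hdet := Matrix.SpecialLinearGroup.det_coe (γ : SL(2, ℤ))
    rw [Matrix.det_fin_two] at hdet
    obtain ⟨c₀, hc₀⟩ := dvd_entry_of_mem_Gamma0 L γ.2
    refine ⟨((γ : SL(2, ℤ)) 0 0 : ℤ), -(((γ : SL(2, ℤ)) 0 1 : ℤ)) * c₀, ?_⟩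
    linear_combination hdet + (((γ : SL(2, ℤ)) 0 1 : ℤ)) * hc₀
  change _ = DirichletCharacter.changeLevel hN ψ ((((γ : SL(2, ℤ)) 1 1 : ℤ)) : ZMod L) *
    DirichletCharacter.changeLevel hmL χ ((((γ : SL(2, ℤ)) 1 1 : ℤ)) : ZMod L) ^ 2
  rw [DirichletCharacter.changeLevel_eq_cast_of_dvd' ψ hN hcop,
    DirichletCharacter.changeLevel_eq_cast_of_dvd' χ hmL hcop]

end Raw

/-! ### `q`-expansion, Hecke operators and the newform of the twist -/

section QExpansion

variable {N : ℕ} [NeZero N] {k : ℤ} {m : ℕ} [NeZero m] (L : ℕ) [NeZero L]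

/-- **`q`-expansion of the raw twist at `τ`**: `∑_u χ⁻¹(u) f(τ + u/m) = ∑_n (∑_u χ⁻¹(u) e^{2πinu/m}) aₙ qⁿ`.
[cite: Shimura1971, Prop. 3.64] -/
theorem hasSum_twistRaw1 (hN : N ∣ L) (hm : m ^ 2 ∣ L) (hNm : N * m ∣ L) {ψ : DirichletCharacter ℂ N}
    {f : CuspForm (Gamma1 N) k} (hf : f ∈ nebentypusSubspace N k ψ) (χ : DirichletCharacter ℂ m) (τ : ℍ) :
    HasSum (fun n : ℕ ↦ ((∑ u : ZMod m, χ⁻¹ u * (ZMod.stdAddChar (u * (n : ZMod m)) : ℂ)) *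
        cuspCoeff f n) • Function.Periodic.qParam 1 (τ : ℂ) ^ n) (twistRaw1 L hN hm hNm hf χ τ) := by
  have hΓ : (1 : ℝ) ∈ ((Gamma1 N : Subgroup SL(2, ℤ)) : Subgroup (GL (Fin 2) ℝ)).strictPeriods :=
    strictWidthInfty_Gamma1 N ▸ Subgroup.strictWidthInfty_mem_strictPeriods _
  have hu : ∀ u : ZMod m, HasSum (fun n : ℕ ↦ (χ⁻¹ u * ((ZMod.stdAddChar (u * (n : ZMod m)) : ℂ) *
      cuspCoeff f n)) • Function.Periodic.qParam 1 (τ : ℂ) ^ n)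
      (χ⁻¹ u * f ((((twistShift u : ℚ) : ℝ)) +ᵥ τ)) := by
    intro u
    have h := UpperHalfPlane.hasSum_qExpansion one_pos
      (SlashInvariantFormClass.periodic_comp_ofComplex f hΓ) (ModularFormClass.holo f)
      (ModularFormClass.bdd_at_infty f) ((((twistShift u : ℚ) : ℝ)) +ᵥ τ)
    have h' : HasSum (fun n : ℕ ↦ (((ZMod.stdAddChar (u * (n : ZMod m)) : ℂ) * cuspCoeff f n)) •
        Function.Periodic.qParam 1 (τ : ℂ) ^ n) (f ((((twistShift u : ℚ) : ℝ)) +ᵥ τ)) := by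
      convert h using 2 with n
      rw [qParam_vadd, mul_pow, smul_eq_mul, smul_eq_mul, cuspCoeff, ← Complex.exp_nat_mul,
        stdAddChar_mul_natCast]
      rw [show ((((u.val : ℚ) / m : ℚ)) : ℂ) = ((((twistShift u : ℚ) : ℝ)) : ℂ) by
        rw [twistShift]; push_cast; rfl]
      ring_nf
    simpa only [smul_eq_mul, mul_assoc] using h'.mul_left (χ⁻¹ u)
  have hsum := hasSum_sum (s := (Finset.univ : Finset (ZMod m))) fun u _ ↦ hu u
  have hval : twistRaw1 L hN hm hNm hf χ τ = ∑ u : ZMod m, χ⁻¹ u * f ((((twistShift u : ℚ) : ℝ)) +ᵥ τ) := by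
    rw [show twistRaw1 L hN hm hNm hf χ τ = (⇑(twistRaw1 L hN hm hNm hf χ) : ℍ → ℂ) τ from rfl, coe_twistRaw1,
      Finset.sum_apply]
    refine Finset.sum_congr rfl fun u _ ↦ ?_
    rw [Pi.smul_apply, slash_twistT_apply, smul_eq_mul]
  rw [hval]
  convert hsum using 1
  funext n
  rw [← Finset.sum_smul, Finset.sum_mul]
  refine congrArg (· • _) (Finset.sum_congr rfl fun u _ ↦ ?_)
  ring

/-- **`q`-expansion of the raw twist by a primitive character**: `aₙ = χ(n) g(χ⁻¹) aₙ(f)`.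
[cite: Shimura1971, Prop. 3.64] -/
theorem cuspCoeff_twistRaw1 (hN : N ∣ L) (hm : m ^ 2 ∣ L) (hNm : N * m ∣ L) {ψ : DirichletCharacter ℂ N}
    {f : CuspForm (Gamma1 N) k} (hf : f ∈ nebentypusSubspace N k ψ) {χ : DirichletCharacter ℂ m}
    (hχ : χ.IsPrimitive) (n : ℕ) :
    cuspCoeff (twistRaw1 L hN hm hNm hf χ) n = χ n * gaussSum χ⁻¹ (ZMod.stdAddChar (N := m)) * cuspCoeff f n := by
  have hΓ' : (1 : ℝ) ∈ ((Gamma1 L : Subgroup SL(2, ℤ)) : Subgroup (GL (Fin 2) ℝ)).strictPeriods :=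
    strictWidthInfty_Gamma1 L ▸ Subgroup.strictWidthInfty_mem_strictPeriods _
  have hsum : ∀ τ : ℍ, HasSum (fun n : ℕ ↦ (χ n * gaussSum χ⁻¹ (ZMod.stdAddChar (N := m)) *
      cuspCoeff f n) • Function.Periodic.qParam 1 (τ : ℂ) ^ n) (twistRaw1 L hN hm hNm hf χ τ) := by
    intro τ
    have h := hasSum_twistRaw1 L hN hm hNm hf χ τ
    simp_rw [sum_inv_mul_stdAddChar_eq hχ] at h
    exact h
  rw [cuspCoeff, ← ModularFormClass.qExpansion_coeff_unique one_pos hΓ' hsum n]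

/-- The raw twist of a form with `a₁ ≠ 0` by a primitive character is non-zero. [folklore] -/
theorem twistRaw1_ne_zero (hN : N ∣ L) (hm : m ^ 2 ∣ L) (hNm : N * m ∣ L) {ψ : DirichletCharacter ℂ N}
    {f : CuspForm (Gamma1 N) k} (hf : f ∈ nebentypusSubspace N k ψ) {χ : DirichletCharacter ℂ m}
    (hχ : χ.IsPrimitive) (hf1 : cuspCoeff f 1 ≠ 0) : twistRaw1 L hN hm hNm hf χ ≠ 0 := by
  intro h
  have h1 := cuspCoeff_twistRaw1 L hN hm hNm hf hχ 1
  rw [h, Nat.cast_one, map_one, one_mul,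
    cuspCoeff_zero_form (strictWidthInfty_Gamma1 L ▸ Subgroup.strictWidthInfty_mem_strictPeriods _)] at h1
  exact mul_ne_zero (gaussSum_stdAddChar_ne_zero_of_isPrimitive (isPrimitive_inv hχ)) hf1 h1.symm

/-- **The twist of a `T_p`-eigenform is a `T_p`-eigenform with eigenvalue multiplied by `χ(p)`**
(`p ∤ L`): `T_p (f ⊗ χ) = χ(p) a_p (f ⊗ χ)` for `T_p f = a_p f` — compare the `q`-expansions
(`aₙ(T_p h) = a_{pn}(h) + ε(p) p^{k-1} a_{n/p}(h)` on both levels). [cite: Shimura1971, Prop. 3.64]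
[cite: AtkinLi1978, §3] -/
theorem heckeT_twistRaw1 (hN : N ∣ L) (hm : m ^ 2 ∣ L) (hNm : N * m ∣ L) {ψ : DirichletCharacter ℂ N}
    {f : CuspForm (Gamma1 N) k} (hf : f ∈ nebentypusSubspace N k ψ) {χ : DirichletCharacter ℂ m}
    (hχ : χ.IsPrimitive) {p : ℕ} [NeZero p] (hp : p.Prime) (hpL : ¬ p ∣ L) {a : ℂ}
    (hT : heckeT (Gamma1 N) k p f = a • f) :
    heckeT (Gamma1 L) k p (twistRaw1 L hN hm hNm hf χ) = (χ p * a) • twistRaw1 L hN hm hNm hf χ := by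
  have hpN : ¬ p ∣ N := fun h => hpL (h.trans hN)
  have hmL : m ∣ L := (Dvd.intro_left _ (sq m).symm).trans hm
  set G := gaussSum χ⁻¹ (ZMod.stdAddChar (N := m)) with hG
  set h := twistRaw1 L hN hm hNm hf χ with hh
  -- `⟨p⟩_L h = ψ(p) χ(p)² h` and `⟨p⟩_N f = ψ(p) f`
  have hunitL : IsUnit (p : ZMod L) := (ZMod.isUnit_prime_iff_not_dvd hp).2 hpL
  have hunitN : IsUnit (p : ZMod N) := (ZMod.isUnit_prime_iff_not_dvd hp).2 hpN
  have hdL : diamondOp L k (p : ZMod L) h = (ψ (p : ZMod N) * χ (p : ZMod m) ^ 2) • h := by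
    have h1 := (mem_nebentypusSubspace_iff_diamondOp.1 (twistRaw1_mem_nebentypusSubspace L hN hm hNm hmL hf χ)) hunitL.unit
    rw [IsUnit.unit_spec] at h1
    rw [← hh] at h1
    rw [h1]
    congr 1
    have hcop : IsCoprime ((p : ℕ) : ℤ) (L : ℤ) := by
      rw [Int.isCoprime_iff_gcd_eq_one]; exact_mod_cast (Nat.Prime.coprime_iff_not_dvd hp).2 hpL
    rw [MulChar.mul_apply, MulChar.pow_apply' _ two_ne_zero, show ((p : ℕ) : ZMod L) = ((p : ℤ) : ZMod L) by simp,
      DirichletCharacter.changeLevel_eq_cast_of_dvd' ψ hN hcop,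
      DirichletCharacter.changeLevel_eq_cast_of_dvd' χ hmL hcop]
    simp
  have hdN : diamondOp N k (p : ZMod N) f = ψ (p : ZMod N) • f := by
    have h1 := (mem_nebentypusSubspace_iff_diamondOp.1 hf) hunitN.unit
    rwa [IsUnit.unit_spec] at h1
  -- compare `q`-expansions
  refine eq_of_forall_cuspCoeff_eq_gamma1 fun n ↦ ?_
  rw [cuspCoeff_heckeT_gamma1 h p hp n, if_neg hpL, hdL, cuspCoeff_smul_gamma1]
  -- `a a_n(f) = a_{pn}(f) + [p ∣ n] ψ(p) p^{k-1} a_{n/p}(f)`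
  have hTn : a * cuspCoeff f n = cuspCoeff f (p * n) +
      (p : ℂ) ^ (k - 1) * (if p ∣ n then ψ (p : ZMod N) * cuspCoeff f (n / p) else 0) := by
    have h2 := cuspCoeff_heckeT_gamma1 f p hp n
    rw [hT, cuspCoeff_smul_gamma1, if_neg hpN, hdN] at h2
    rw [h2]
    congr 2
    split_ifs
    · rw [cuspCoeff_smul_gamma1]
    · rfl
  by_cases hpn : p ∣ n
  · obtain ⟨n', rfl⟩ := hpn
    rw [if_pos (dvd_mul_right p n'), Nat.mul_div_cancel_left n' hp.pos, cuspCoeff_smul_gamma1,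
      cuspCoeff_twistRaw1 L hN hm hNm hf hχ (p * (p * n')), cuspCoeff_twistRaw1 L hN hm hNm hf hχ n',
      cuspCoeff_twistRaw1 L hN hm hNm hf hχ (p * n')]
    rw [if_pos (dvd_mul_right p n'), Nat.mul_div_cancel_left n' hp.pos] at hTn
    simp only [Nat.cast_mul, map_mul] at hTn ⊢
    linear_combination -(χ (p : ZMod m) * χ (p : ZMod m) * χ (n' : ZMod m) * G) * hTn
  · rw [if_neg hpn, mul_zero, add_zero, cuspCoeff_smul_gamma1, cuspCoeff_twistRaw1 L hN hm hNm hf hχ (p * n),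
      cuspCoeff_twistRaw1 L hN hm hNm hf hχ n]
    rw [if_neg hpn, mul_zero, add_zero] at hTn
    simp only [Nat.cast_mul, map_mul] at hTn ⊢
    linear_combination -(χ (p : ZMod m) * χ (n : ZMod m) * G) * hTn

/-- **The newform of a twist** (Shimura 1971, Prop. 3.64 with Atkin–Lehner–Li theory,
Diamond–Shurman Thm. 5.8.2–5.8.3): for a newform `g ∈ S_k(Γ₁(N))` and a primitive Dirichlet
character `χ mod m` there is a newform `g₀` of level dividing `N m²` with `a_p(g₀) = χ(p) a_p(g)`
and `ε_{g₀}(p) = ε_g(p) χ(p)²` for every prime `p ∤ N m`. [cite: Shimura1971, Prop. 3.64]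
[cite: DiamondShurman2005, Thm. 5.8.2–5.8.3] -/
theorem exists_isNewform1_twist {g : CuspForm (Gamma1 N) k} (hg : IsNewform1 g) {χ : DirichletCharacter ℂ m}
    (hχ : χ.IsPrimitive) :
    ∃ (N₀ : ℕ) (_ : NeZero N₀) (_ : N₀ ∣ N * m ^ 2) (g₀ : CuspForm (Gamma1 N₀) k), IsNewform1 g₀ ∧
      ∀ p : ℕ, p.Prime → ¬ p ∣ N * m →
        cuspCoeff g₀ p = χ p * cuspCoeff g p ∧
          (nebentypus g₀ (p : ZMod N₀) : ℂ) = nebentypus g (p : ZMod N) * χ (p : ZMod m) ^ 2 := by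
  haveI : NeZero (N * m ^ 2) := ⟨mul_ne_zero (NeZero.ne N) (pow_ne_zero 2 (NeZero.ne m))⟩
  have hN : N ∣ N * m ^ 2 := dvd_mul_right N _
  have hm : m ^ 2 ∣ N * m ^ 2 := dvd_mul_left _ N
  have hNm : N * m ∣ N * m ^ 2 := mul_dvd_mul_left N (Dvd.intro_left _ (sq m).symm)
  have hmL : m ∣ N * m ^ 2 := (Dvd.intro_left _ (sq m).symm).trans hm
  have hgε := IsNewform1.mem_nebentypusSubspace_nebentypus_holds hg
  set h := twistRaw1 (N * m ^ 2) hN hm hNm hgε χ with hh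
  have hh0 : h ≠ 0 := twistRaw1_ne_zero _ hN hm hNm hgε hχ (by
    rw [(isNormalized_iff_cuspCoeff_one g).1 hg.2.2.2]; exact one_ne_zero)
  have hmem := twistRaw1_mem_nebentypusSubspace (N * m ^ 2) hN hm hNm hmL hgε χ
  have hT : ∀ (p : ℕ) (hp : p.Prime), ¬ p ∣ N * m ^ 2 →
      (haveI : NeZero p := ⟨hp.ne_zero⟩; heckeT (Gamma1 (N * m ^ 2)) k p h) = (χ p * cuspCoeff g p) • h := by
    intro p hp hpL
    haveI : NeZero p := ⟨hp.ne_zero⟩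
    exact heckeT_twistRaw1 _ hN hm hNm hgε hχ hp hpL (hg.heckeT_apply_eq_cuspCoeff_smul p hp)
  obtain ⟨N₀, _, hN₀, g₀, hnew, hcoeff, hchar⟩ := exists_isNewform1_of_eigenpacket hh0 hmem hT
  refine ⟨N₀, inferInstance, hN₀, g₀, hnew, fun p hp hpNm => ?_⟩
  have hpL : ¬ p ∣ N * m ^ 2 := by
    intro h'
    rcases (Nat.Prime.dvd_mul hp).1 h' with h'' | h''
    · exact hpNm (h''.trans (dvd_mul_right N m))
    · exact hpNm ((Nat.Prime.dvd_of_dvd_pow hp h'').trans (dvd_mul_left m N))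
  refine ⟨hcoeff p hp hpL, ?_⟩
  have hcop : IsCoprime ((p : ℕ) : ℤ) ((N * m ^ 2 : ℕ) : ℤ) := by
    rw [Int.isCoprime_iff_gcd_eq_one]; exact_mod_cast (Nat.Prime.coprime_iff_not_dvd hp).2 hpL
  have e := congrArg (fun χ' : DirichletCharacter ℂ (N * m ^ 2) => χ' ((p : ℕ) : ℤ)) hchar
  rw [DirichletCharacter.changeLevel_eq_cast_of_dvd' _ hN₀ hcop, MulChar.mul_apply, MulChar.pow_apply' _ two_ne_zero,
    DirichletCharacter.changeLevel_eq_cast_of_dvd' _ hN hcop,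
    DirichletCharacter.changeLevel_eq_cast_of_dvd' χ hmL hcop] at e
  push_cast at e
  exact e

end QExpansion

end Literature.NumberTheory.EllipticCurves.ModularForms

end
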